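import Mathlib
import HarnessLib
import Summits.Parity.GeneralizedHardyLittlewood.Theses.LiouvilleMAD
import Summits.Parity.GeneralizedHardyLittlewood.Theorems.FanDecorrelation.Negative.FanDecorrelationBlockVariance
import Summits.Parity.GeneralizedHardyLittlewood.Theorems.DilatedChowla.Negative.DilatedChowlaMirror

/-!
# `FanDecorrelation` (stmt-Parity-13318) ALONE contains an effective Landau–Siegel theorem

Negation-side hardness certificate for the crux `LiouvilleMAD.FanDecorrelation` (route LiouvilleMAD, rank 3).
Written by the crux strategist (unit `cstrat-stmt-Parity-13318-p1`, tree work file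
`Cruxes/FanDecorrelation/StrategistMirror.lean` @b4a7ca638d55, 2026-08-17, census heading NEGATION N3); landed
verbatim by the line lead c5 (planner seats cannot write under `Theorems/`).

THEOREM (`fanSiegelMirror`).  `FanDecorrelation → ∃ C₀ > 0, ¬ SiegelZerosAbove (C₀ · log)`; equivalently
(`fanSiegelMirror_realZeroFree`) `L(σ, χ) ≠ 0` for all large `q`, all primitive quadratic `χ mod q`, all
`σ ∈ [1 − 1/(C₀ log² q), 1)`.  Unconditionally only Siegel's ineffective `1 − β ≥ C(ε) q^{−ε}` is known, so no
proof of the fan crux is cheaper than an effective Landau–Siegel theorem of that quality.  This upgrades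
`realZeroFree_of_MAD` (`FanDecorrelationSiegelMirror`, p119683), which needs BOTH MAD cruxes
(`CosetDecorrelation ∧ FanDecorrelation → DilatedChowla →` Siegel mirror), to the fan crux BY ITSELF: neither half
of MAD is the easy half (cf. the sibling `cosetSiegelMirror` for stmt-Parity-13317).

MECHANISM (`not_coherentBias_of_fanDecorrelation`).  Let `CoherentBias c` hold (tree def: for every `κ > 0`, `C'`
a family of `V` progressions `c mod qν`, `1 ≤ ν ≤ V`, `qV ≤ 2M`, whose one-point sums `P c (qν) M = Σ_{m∼M} λ(mqν+c)`
share a sign and are `≥ bM`, with `b²V ≥ 4`, `V·C' ≤ M^κ`).  With `w(m) = Σ_ν λ(m·qν + c)`, block length `K = 4V`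
and the short block sums `B_j` of `FanDecorrelationBlockVariance`:
Cauchy–Schwarz gives `Q·(KVbM)² ≤ Σ_j #T_j · Σ_{T_j} B_j² ≤ 2M · Σ_j Σ_{T_j} B_j²`, the expansion `sum_j_sum_B_sq`
turns the right side into fans, the `k = 0` and `ν = ν'` fans are bounded TRIVIALLY by `QM` and the rest by the
crux: `64·QV³M² ≤ 40·QV³M² + 32·V⁴C·M^{7/4+ϑ}`, i.e. `3QM² ≤ 4VC·M^{7/4+ϑ} ≤ M^{7/4+ϑ+κ}`, impossible for
`κ ≤ (1/4 − ϑ)/2`.  The Siegel input is the LANDED chain `coherentBias_one_of_siegelZerosAbove`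
(`Theorems/DilatedChowla/Negative/DilatedChowlaMirror`, black box).  The hypothesis of the `_false_of_` form
(Siegel zeros of every logarithmic quality at arbitrarily large conductors) is believed false: a HARDNESS
certificate, not a refutation mechanism.  [folklore]
-/

noncomputable section

namespace Summit.Parity.GeneralizedHardyLittlewood.Theorems.FanDecorrelation.Negative

open Finset
open Summit.Parity.GeneralizedHardyLittlewood.Theses.LiouvilleMAD (FanDecorrelation)
open Summit.Parity.GeneralizedHardyLittlewood.Theorems.DilatedTableChowla.Negative (L abs_L_le_one)
open Summit.Parity.GeneralizedHardyLittlewood.Theorems.DilatedChowla.Negative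
  (P CoherentBias SiegelZerosAbove coherentBias_one_of_siegelZerosAbove
    realZeroFree_of_not_siegelZerosAbove)
open Summit.Parity.GeneralizedHardyLittlewood.Theorems.FanDecorrelation.Negative.BlockVariance

/-! ## §3 The fan side: bounding the expanded block variance by the crux -/

/-- Under the crux bound for the family `qν`, `ν ≤ V` (off-diagonal, nonzero lag), the expanded block
variance is at most `K·V²·(QM) + K²·V·(QM) + K²·V²·C·M^{3/4+ϑ}`. -/
theorem fan_side_le {c : ℤ} {M q V K : ℕ} {C e : ℝ} (hC : 0 ≤ C)
    (hfan : ∀ ν ∈ Icc 1 V, ∀ ν' ∈ Icc 1 V, ν ≠ ν' → ∀ k : ℤ, k ≠ 0 →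
      |fan c (q * ν) (q * ν') M k| ≤ C * (M : ℝ) ^ e) :
    ∑ s ∈ range K, ∑ s' ∈ range K, ∑ ν ∈ Icc 1 V, ∑ ν' ∈ Icc 1 V,
        fan c (q * ν) (q * ν') M ((s : ℤ) - s') ≤
      (K : ℝ) * V ^ 2 * (((Nat.sqrt M : ℝ) + 1) * M) + (K : ℝ) ^ 2 * V * (((Nat.sqrt M : ℝ) + 1) * M)
        + (K : ℝ) ^ 2 * V ^ 2 * (C * (M : ℝ) ^ e) := by
  set QM : ℝ := ((Nat.sqrt M : ℝ) + 1) * M with hQM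
  set CM : ℝ := C * (M : ℝ) ^ e with hCM
  have hQM0 : 0 ≤ QM := by positivity
  have hCM0 : 0 ≤ CM := by positivity
  -- pointwise bound
  have hpt : ∀ s ∈ range K, ∀ s' ∈ range K, ∀ ν ∈ Icc 1 V, ∀ ν' ∈ Icc 1 V,
      fan c (q * ν) (q * ν') M ((s : ℤ) - s') ≤
        (if s = s' then QM else 0) + (if ν = ν' then QM else 0) + CM := by
    intro s hs s' hs' ν hν ν' hν'
    have htriv : fan c (q * ν) (q * ν') M ((s : ℤ) - s') ≤ QM :=
      le_trans (le_abs_self _) (abs_fan_le _ _ _ _ _)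
    by_cases hss : s = s'
    · rw [if_pos hss]
      have : 0 ≤ (if ν = ν' then QM else 0) := by split_ifs <;> linarith
      linarith
    · rw [if_neg hss, zero_add]
      by_cases hνν : ν = ν'
      · rw [if_pos hνν]; linarith
      · rw [if_neg hνν, zero_add]
        have hk : ((s : ℤ) - s') ≠ 0 := by
          intro h
          apply hss
          exact_mod_cast (sub_eq_zero.mp h)
        exact le_trans (le_abs_self _) (hfan ν hν ν' hν' hνν _ hk)
  -- sum it
  have hsum1 : ∀ s ∈ range K, ∑ s' ∈ range K, (if s = s' then QM else 0) = QM := by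
    intro s hs
    rw [sum_ite_eq (range K) s (fun _ => QM), if_pos hs]
  have hsum2 : ∀ ν ∈ Icc 1 V, ∑ ν' ∈ Icc 1 V, (if ν = ν' then QM else 0) = QM := by
    intro ν hν
    rw [sum_ite_eq (Icc 1 V) ν (fun _ => QM), if_pos hν]
  calc ∑ s ∈ range K, ∑ s' ∈ range K, ∑ ν ∈ Icc 1 V, ∑ ν' ∈ Icc 1 V,
        fan c (q * ν) (q * ν') M ((s : ℤ) - s')
      ≤ ∑ s ∈ range K, ∑ s' ∈ range K, ∑ ν ∈ Icc 1 V, ∑ ν' ∈ Icc 1 V,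
          ((if s = s' then QM else 0) + (if ν = ν' then QM else 0) + CM) :=
        sum_le_sum fun s hs => sum_le_sum fun s' hs' => sum_le_sum fun ν hν =>
          sum_le_sum fun ν' hν' => hpt s hs s' hs' ν hν ν' hν'
    _ = ∑ s ∈ range K, ∑ s' ∈ range K,
          ((V : ℝ) ^ 2 * (if s = s' then QM else 0) + V * QM + V ^ 2 * CM) := by
        refine sum_congr rfl fun s _ => sum_congr rfl fun s' _ => ?_
        have : ∀ ν ∈ Icc 1 V, ∑ ν' ∈ Icc 1 V,
            ((if s = s' then QM else 0) + (if ν = ν' then QM else 0) + CM) =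
            (V : ℝ) * (if s = s' then QM else 0) + QM + V * CM := by
          intro ν hν
          rw [sum_add_distrib, sum_add_distrib, hsum2 ν hν, sum_const, sum_const, Nat.card_Icc,
            Nat.add_sub_cancel, nsmul_eq_mul, nsmul_eq_mul]
        rw [sum_congr rfl this, sum_add_distrib, sum_add_distrib, sum_const, sum_const, sum_const,
          Nat.card_Icc, Nat.add_sub_cancel, nsmul_eq_mul, nsmul_eq_mul, nsmul_eq_mul]
        ring
    _ = ∑ s ∈ range K, ((V : ℝ) ^ 2 * QM + K * (V * QM) + K * (V ^ 2 * CM)) := by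
        refine sum_congr rfl fun s hs => ?_
        have hA : ∑ s' ∈ range K, (V : ℝ) ^ 2 * (if s = s' then QM else 0) = (V : ℝ) ^ 2 * QM := by
          rw [← mul_sum, hsum1 s hs]
        rw [sum_add_distrib, sum_add_distrib, hA, sum_const, sum_const,
          card_range, nsmul_eq_mul, nsmul_eq_mul]
    _ = (K : ℝ) * V ^ 2 * QM + (K : ℝ) ^ 2 * V * QM + (K : ℝ) ^ 2 * V ^ 2 * CM := by
        rw [sum_add_distrib, sum_add_distrib, sum_const, sum_const, sum_const, card_range,
          nsmul_eq_mul, nsmul_eq_mul, nsmul_eq_mul]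
        ring

/-! ## §4 The block side: Cauchy–Schwarz lower bound -/

/-- `(K·Σ_m w)² ≤ #T_j · Σ_{T_j} B_j²`. -/
theorem block_side_ge (c : ℤ) (M q V K j : ℕ) :
    ((K : ℝ) * ∑ m ∈ Ioc M (2 * M), w c q V m) ^ 2 ≤
      ((T M K j).card : ℝ) * ∑ m₀ ∈ T M K j, (B c M q V K j m₀) ^ 2 := by
  rw [← sum_B]
  have h := sum_mul_sq_le_sq_mul_sq (T M K j) (fun _ => (1 : ℝ)) (fun m₀ => B c M q V K j m₀)
  simp only [one_mul, one_pow, sum_const, nsmul_eq_mul, mul_one] at h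
  exact h

/-! ## §5 The mirror -/

/-- **Short-block positivity over a dilation family.**  For `c ≠ 0`, a coherent class bias at shift
`c` is incompatible with the fan crux `FanDecorrelation` ALONE. -/
theorem not_coherentBias_of_fanDecorrelation {c : ℤ} (hc : c ≠ 0) (hF : FanDecorrelation) :
    ¬ CoherentBias c := by
  intro hB
  obtain ⟨ϑ, hϑ, C, hCfan⟩ := fanDecorrelation_iff.mp hF c hc
  -- constants
  obtain ⟨Cp, hCp⟩ : ∃ Cp : ℝ, Cp = max C 0 := ⟨_, rfl⟩
  have hCp0 : 0 ≤ Cp := by rw [hCp]; exact le_max_right _ _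
  have hCle : C ≤ Cp := by rw [hCp]; exact le_max_left _ _
  obtain ⟨κ, hκ⟩ : ∃ κ : ℝ, κ = min (1 / 8) ((1 / 4 - ϑ) / 2) := ⟨_, rfl⟩
  have hκpos : 0 < κ := by
    rw [hκ]; apply lt_min
    · norm_num
    · linarith
  have hκ8 : κ ≤ 1 / 8 := by rw [hκ]; exact min_le_left _ _
  have hκϑ : κ ≤ (1 / 4 - ϑ) / 2 := by rw [hκ]; exact min_le_right _ _
  obtain ⟨M, q, V, b, σ, hσ, hq, hV, hqV, hb, hbV, hVC, hP⟩ := hB κ hκpos (4 * Cp + 4)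
  -- basic positivity
  have hM1 : 1 ≤ M := by
    have := Nat.mul_le_mul hq hV
    omega
  have hMr1 : (1 : ℝ) ≤ M := by exact_mod_cast hM1
  have hMpos : (0 : ℝ) < M := by linarith
  have hVr1 : (1 : ℝ) ≤ V := by exact_mod_cast hV
  have hVpos : (0 : ℝ) < V := by linarith
  -- the modulus count `Qr = ⌊√M⌋ + 1`
  obtain ⟨Qr, hQr⟩ : ∃ Qr : ℝ, Qr = (Nat.sqrt M : ℝ) + 1 := ⟨_, rfl⟩
  have hQ1 : (1 : ℝ) ≤ Qr := by
    rw [hQr]; linarith [(Nat.cast_nonneg (Nat.sqrt M) : (0:ℝ) ≤ _)]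
  have hQpos : (0 : ℝ) < Qr := by linarith
  have hsqrtM1 : (1 : ℝ) ≤ Real.sqrt M := by
    rw [show (1 : ℝ) = Real.sqrt 1 by simp]
    exact Real.sqrt_le_sqrt hMr1
  have hQle : Qr ≤ 2 * Real.sqrt M := by
    have h1 : (Nat.sqrt M : ℝ) ≤ Real.sqrt M := by
      have hsq : ((Nat.sqrt M : ℝ)) ^ 2 ≤ M := by
        have := Nat.sqrt_le' M
        exact_mod_cast this
      calc (Nat.sqrt M : ℝ) = Real.sqrt (((Nat.sqrt M : ℝ)) ^ 2) := by
            rw [Real.sqrt_sq (Nat.cast_nonneg _)]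
        _ ≤ Real.sqrt M := Real.sqrt_le_sqrt hsq
    rw [hQr]; linarith
  have hJcard : ((Ico (Nat.sqrt M + 1) (2 * (Nat.sqrt M + 1))).card : ℝ) = Qr := by
    have hc' : (Ico (Nat.sqrt M + 1) (2 * (Nat.sqrt M + 1))).card = Nat.sqrt M + 1 := by
      rw [Nat.card_Ico]; omega
    rw [hc', hQr]; push_cast; ring
  -- `4V ≤ M^κ` and `4 V Cp ≤ M^κ`
  have hVCp0 : 0 ≤ (V : ℝ) * Cp := mul_nonneg hVpos.le hCp0
  have hV4 : 4 * (V : ℝ) ≤ (M : ℝ) ^ κ := by linarith only [hVC, hVCp0]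
  have hVC4 : 4 * (V : ℝ) * Cp ≤ (M : ℝ) ^ κ := by linarith only [hVC, hVCp0, hVpos]
  -- rpow bookkeeping
  have hMκ_le_18 : (M : ℝ) ^ κ ≤ (M : ℝ) ^ (1 / 8 : ℝ) :=
    Real.rpow_le_rpow_of_exponent_le hMr1 hκ8
  have hMκ_ge4 : (4 : ℝ) ≤ (M : ℝ) ^ κ := by linarith only [hV4, hVr1]
  have hM38_ge4 : (4 : ℝ) ≤ (M : ℝ) ^ (3 / 8 : ℝ) :=
    le_trans hMκ_ge4 (Real.rpow_le_rpow_of_exponent_le hMr1 (by linarith))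
  -- the block length `K = 4V`
  obtain ⟨K, hKdef⟩ : ∃ K : ℕ, K = 4 * V := ⟨_, rfl⟩
  have hKr : (K : ℝ) = 4 * V := by rw [hKdef]; push_cast; ring
  have hK1 : 1 ≤ K := by rw [hKdef]; omega
  have hKpos : (0 : ℝ) < K := by rw [hKr]; linarith
  -- `2 Qr K ≤ M`
  have h2QK : 2 * Qr * K ≤ M := by
    have h58 : Real.sqrt M * (M : ℝ) ^ (1 / 8 : ℝ) = (M : ℝ) ^ (5 / 8 : ℝ) := by
      rw [Real.sqrt_eq_rpow, ← Real.rpow_add hMpos]; norm_num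
    have h1 : (M : ℝ) ^ (5 / 8 : ℝ) * (M : ℝ) ^ (3 / 8 : ℝ) = M := by
      rw [← Real.rpow_add hMpos]; norm_num
    have h58pos : 0 ≤ (M : ℝ) ^ (5 / 8 : ℝ) := Real.rpow_nonneg hMpos.le _
    have h18 : 4 * (V : ℝ) ≤ (M : ℝ) ^ (1 / 8 : ℝ) := le_trans hV4 hMκ_le_18
    have hs0 : 0 ≤ Real.sqrt M := Real.sqrt_nonneg _
    have hA : 2 * Qr * (4 * (V : ℝ)) ≤ 2 * (2 * Real.sqrt M) * (4 * V) := by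
      have := mul_le_mul_of_nonneg_right hQle (show (0:ℝ) ≤ 4 * V by linarith only [hVpos])
      linarith only [this]
    have hB' : 2 * (2 * Real.sqrt M) * (4 * (V : ℝ)) ≤ 2 * (2 * Real.sqrt M) * (M : ℝ) ^ (1 / 8 : ℝ) := by
      have := mul_le_mul_of_nonneg_left h18 (show (0:ℝ) ≤ 2 * (2 * Real.sqrt M) by linarith only [hs0])
      linarith only [this]
    have hC' : 4 * (M : ℝ) ^ (5 / 8 : ℝ) ≤ (M : ℝ) ^ (3 / 8 : ℝ) * (M : ℝ) ^ (5 / 8 : ℝ) := by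
      have := mul_le_mul_of_nonneg_right hM38_ge4 h58pos
      linarith only [this]
    calc 2 * Qr * K = 2 * Qr * (4 * V) := by rw [hKr]
      _ ≤ 2 * (2 * Real.sqrt M) * (4 * V) := hA
      _ ≤ 2 * (2 * Real.sqrt M) * (M : ℝ) ^ (1 / 8 : ℝ) := hB'
      _ = 4 * (M : ℝ) ^ (5 / 8 : ℝ) := by rw [← h58]; ring
      _ ≤ (M : ℝ) ^ (3 / 8 : ℝ) * (M : ℝ) ^ (5 / 8 : ℝ) := hC'
      _ = M := by rw [mul_comm, h1]
  -- the fan hypothesis on the family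
  have hfan : ∀ ν ∈ Icc 1 V, ∀ ν' ∈ Icc 1 V, ν ≠ ν' → ∀ k : ℤ, k ≠ 0 →
      |fan c (q * ν) (q * ν') M k| ≤ Cp * (M : ℝ) ^ (3 / 4 + ϑ) := by
    intro ν hν ν' hν' hνν k hk
    rw [mem_Icc] at hν hν'
    have h := hCfan M (q * ν) (q * ν') k
      ((one_mul 1).symm.trans_le (Nat.mul_le_mul hq hν.1))
      ((one_mul 1).symm.trans_le (Nat.mul_le_mul hq hν'.1))
      (fun heq => hνν (Nat.eq_of_mul_eq_mul_left (by omega) heq))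
      (le_trans (Nat.mul_le_mul_left q hν.2) hqV)
      (le_trans (Nat.mul_le_mul_left q hν'.2) hqV) hk
    exact le_trans h (mul_le_mul_of_nonneg_right hCle (Real.rpow_nonneg hMpos.le _))
  -- the family sum
  obtain ⟨Wsum, hWsum⟩ : ∃ Wsum : ℝ, Wsum = ∑ m ∈ Ioc M (2 * M), w c q V m := ⟨_, rfl⟩
  -- (1) lower bound on the family sum: `Wsum² ≥ (V b M)²`
  have hW : ((V : ℝ) * (b * M)) ^ 2 ≤ Wsum ^ 2 := by
    have hsum : (V : ℝ) * (b * M) ≤ σ * Wsum := by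
      rw [hWsum, sum_w_eq, mul_sum]
      calc (V : ℝ) * (b * M) = ∑ _ν ∈ Icc 1 V, b * M := by
            rw [sum_const, Nat.card_Icc, Nat.add_sub_cancel, nsmul_eq_mul]
        _ ≤ ∑ ν ∈ Icc 1 V, σ * P c (q * ν) M :=
            sum_le_sum fun ν hν => by
              rw [mem_Icc] at hν
              exact hP ν hν.1 hν.2
    have hnn : 0 ≤ (V : ℝ) * (b * M) := by positivity
    have hσ2 : σ ^ 2 = 1 := by rcases hσ with h | h <;> simp [h]
    calc ((V : ℝ) * (b * M)) ^ 2 ≤ (σ * Wsum) ^ 2 := by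
          exact pow_le_pow_left₀ hnn hsum 2
      _ = Wsum ^ 2 := by rw [mul_pow, hσ2, one_mul]
  -- (2) per-modulus block inequality and its sum over `j`
  have hblock : ∀ j ∈ Ico (Nat.sqrt M + 1) (2 * (Nat.sqrt M + 1)), ((K : ℝ) * Wsum) ^ 2 ≤
      2 * (M : ℝ) * ∑ m₀ ∈ T M K j, (B c M q V K j m₀) ^ 2 := by
    intro j hj
    have hjlt : (j : ℝ) ≤ 2 * Qr := by
      rw [mem_Ico] at hj
      have : (j : ℝ) < ((2 * (Nat.sqrt M + 1) : ℕ) : ℝ) := by exact_mod_cast hj.2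
      push_cast at this
      rw [hQr]; linarith
    have hT : ((T M K j).card : ℝ) ≤ 2 * M := by
      rw [card_T M K j hK1]
      have hj0 : (0 : ℝ) ≤ j := Nat.cast_nonneg _
      have h1 : ((K : ℝ) - 1) * j ≤ (K : ℝ) * j := by
        rw [sub_mul, one_mul]; linarith only [hj0]
      have h2 : (K : ℝ) * j ≤ (K : ℝ) * (2 * Qr) := mul_le_mul_of_nonneg_left hjlt hKpos.le
      linarith only [h1, h2, h2QK]
    have hnn : 0 ≤ ∑ m₀ ∈ T M K j, (B c M q V K j m₀) ^ 2 := sum_nonneg fun _ _ => sq_nonneg _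
    calc ((K : ℝ) * Wsum) ^ 2 ≤ ((T M K j).card : ℝ) * ∑ m₀ ∈ T M K j, (B c M q V K j m₀) ^ 2 := by
          rw [hWsum]; exact block_side_ge c M q V K j
      _ ≤ 2 * (M : ℝ) * ∑ m₀ ∈ T M K j, (B c M q V K j m₀) ^ 2 :=
          mul_le_mul_of_nonneg_right hT hnn
  have hmain : Qr * ((K : ℝ) * Wsum) ^ 2 ≤
      2 * (M : ℝ) * ((K : ℝ) * V ^ 2 * (Qr * M) + (K : ℝ) ^ 2 * V * (Qr * M)
        + (K : ℝ) ^ 2 * V ^ 2 * (Cp * (M : ℝ) ^ (3 / 4 + ϑ))) := by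
    calc Qr * ((K : ℝ) * Wsum) ^ 2
        = ∑ _j ∈ Ico (Nat.sqrt M + 1) (2 * (Nat.sqrt M + 1)), ((K : ℝ) * Wsum) ^ 2 := by
          rw [sum_const, nsmul_eq_mul, hJcard]
      _ ≤ ∑ j ∈ Ico (Nat.sqrt M + 1) (2 * (Nat.sqrt M + 1)),
            2 * (M : ℝ) * ∑ m₀ ∈ T M K j, (B c M q V K j m₀) ^ 2 :=
          sum_le_sum hblock
      _ = 2 * (M : ℝ) * ∑ j ∈ Ico (Nat.sqrt M + 1) (2 * (Nat.sqrt M + 1)),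
            ∑ m₀ ∈ T M K j, (B c M q V K j m₀) ^ 2 := by
          rw [mul_sum]
      _ = 2 * (M : ℝ) * ∑ s ∈ range K, ∑ s' ∈ range K, ∑ ν ∈ Icc 1 V, ∑ ν' ∈ Icc 1 V,
            fan c (q * ν) (q * ν') M ((s : ℤ) - s') := by
          rw [sum_j_sum_B_sq]
      _ ≤ 2 * (M : ℝ) * ((K : ℝ) * V ^ 2 * (((Nat.sqrt M : ℝ) + 1) * M)
            + (K : ℝ) ^ 2 * V * (((Nat.sqrt M : ℝ) + 1) * M)
            + (K : ℝ) ^ 2 * V ^ 2 * (Cp * (M : ℝ) ^ (3 / 4 + ϑ))) := by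
          refine mul_le_mul_of_nonneg_left (fan_side_le hCp0 hfan) (by positivity)
      _ = _ := by rw [← hQr]
  -- (3) arithmetic: combine (1), (2) with `K = 4V`, `b²V ≥ 4`
  obtain ⟨E, hE⟩ : ∃ E : ℝ, E = (M : ℝ) ^ (3 / 4 + ϑ) := ⟨_, rfl⟩
  have hE0 : 0 ≤ E := by rw [hE]; exact Real.rpow_nonneg hMpos.le _
  rw [← hE] at hmain
  -- from hmain and hW:  Qr K² (VbM)² ≤ 2M (K V² Qr M + K² V Qr M + K² V² Cp E)
  have h3 : Qr * (K : ℝ) ^ 2 * ((V : ℝ) * (b * M)) ^ 2 ≤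
      2 * (M : ℝ) * ((K : ℝ) * V ^ 2 * (Qr * M) + (K : ℝ) ^ 2 * V * (Qr * M)
        + (K : ℝ) ^ 2 * V ^ 2 * (Cp * E)) := by
    have hKW : (K : ℝ) ^ 2 * ((V : ℝ) * (b * M)) ^ 2 ≤ (K : ℝ) ^ 2 * Wsum ^ 2 :=
      mul_le_mul_of_nonneg_left hW (sq_nonneg _)
    have hQKW : Qr * ((K : ℝ) ^ 2 * ((V : ℝ) * (b * M)) ^ 2) ≤ Qr * ((K : ℝ) ^ 2 * Wsum ^ 2) :=
      mul_le_mul_of_nonneg_left hKW hQpos.le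
    calc Qr * (K : ℝ) ^ 2 * ((V : ℝ) * (b * M)) ^ 2
        = Qr * ((K : ℝ) ^ 2 * ((V : ℝ) * (b * M)) ^ 2) := by ring
      _ ≤ Qr * ((K : ℝ) ^ 2 * Wsum ^ 2) := hQKW
      _ = Qr * ((K : ℝ) * Wsum) ^ 2 := by ring
      _ ≤ _ := hmain
  -- substitute K = 4V and use b² V ≥ 4
  have hb2V : 4 ≤ b ^ 2 * (V : ℝ) := hbV
  have h4 : 64 * Qr * (V : ℝ) ^ 3 * (M : ℝ) ^ 2 ≤
      40 * Qr * (V : ℝ) ^ 3 * (M : ℝ) ^ 2 + 32 * (V : ℝ) ^ 4 * Cp * (M * E) := by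
    rw [hKr] at h3
    have hl : 64 * Qr * (V : ℝ) ^ 3 * (M : ℝ) ^ 2 ≤
        Qr * (4 * (V : ℝ)) ^ 2 * ((V : ℝ) * (b * M)) ^ 2 := by
      have hfac : Qr * (4 * (V : ℝ)) ^ 2 * ((V : ℝ) * (b * M)) ^ 2 =
          16 * Qr * (V : ℝ) ^ 3 * (M : ℝ) ^ 2 * (b ^ 2 * V) := by ring
      rw [hfac]
      have hpos : 0 ≤ 16 * Qr * (V : ℝ) ^ 3 * (M : ℝ) ^ 2 := by positivity
      have := mul_le_mul_of_nonneg_left hb2V hpos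
      linarith only [this]
    have hr : 2 * (M : ℝ) * (4 * (V : ℝ) * (V : ℝ) ^ 2 * (Qr * M)
        + (4 * (V : ℝ)) ^ 2 * V * (Qr * M) + (4 * (V : ℝ)) ^ 2 * (V : ℝ) ^ 2 * (Cp * E)) =
        40 * Qr * (V : ℝ) ^ 3 * (M : ℝ) ^ 2 + 32 * (V : ℝ) ^ 4 * Cp * (M * E) := by ring
    linarith
  -- hence `3 Qr M² ≤ 4 V Cp (M E) ≤ M^κ (M E)`
  have h5 : 3 * Qr * (M : ℝ) ^ 2 ≤ (M : ℝ) ^ κ * (M * E) := by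
    have hV3 : (0 : ℝ) < (V : ℝ) ^ 3 := by positivity
    have h6 : 24 * Qr * (M : ℝ) ^ 2 ≤ 32 * (V : ℝ) * Cp * (M * E) := by
      have hfac : 32 * (V : ℝ) ^ 4 * Cp * (M * E) = (V : ℝ) ^ 3 * (32 * (V : ℝ) * Cp * (M * E)) := by
        ring
      rw [hfac] at h4
      have h7 : (V : ℝ) ^ 3 * (24 * Qr * (M : ℝ) ^ 2) ≤
          (V : ℝ) ^ 3 * (32 * (V : ℝ) * Cp * (M * E)) := by linarith only [h4]
      exact le_of_mul_le_mul_left h7 hV3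
    have hME : 0 ≤ (M : ℝ) * E := by positivity
    have h9 := mul_le_mul_of_nonneg_right hVC4 hME
    linarith only [h6, h9]
  -- but `M^κ · M · E = M^{κ + 1 + 3/4 + ϑ} ≤ M² < 3 Qr M²`
  have h8 : (M : ℝ) ^ κ * (M * E) ≤ (M : ℝ) ^ 2 := by
    have hexp' : (M : ℝ) ^ κ * (M * E) = (M : ℝ) ^ (κ + 1 + (3 / 4 + ϑ)) := by
      rw [hE, Real.rpow_add hMpos (κ + 1) (3 / 4 + ϑ), Real.rpow_add hMpos κ 1, Real.rpow_one]; ring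
    rw [hexp']
    have hexp : κ + 1 + (3 / 4 + ϑ) ≤ (2 : ℝ) := by linarith
    calc (M : ℝ) ^ (κ + 1 + (3 / 4 + ϑ)) ≤ (M : ℝ) ^ (2 : ℝ) :=
          Real.rpow_le_rpow_of_exponent_le hMr1 hexp
      _ = (M : ℝ) ^ 2 := by exact_mod_cast Real.rpow_natCast (M : ℝ) 2
  have hM2 : (0 : ℝ) < (M : ℝ) ^ 2 := by positivity
  have h10 := mul_le_mul_of_nonneg_right hQ1 hM2.le
  linarith only [h5, h8, h10, hM2]


/-- **The fan Siegel mirror.**  `FanDecorrelation` alone implies that Siegel zeros of quality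
`≥ C₀ log q` do not occur at arbitrarily large conductors. -/
theorem fanSiegelMirror (hF : FanDecorrelation) :
    ∃ C₀ : ℝ, 0 < C₀ ∧ ¬ SiegelZerosAbove (fun q => C₀ * Real.log q) := by
  obtain ⟨C₀, hC₀, himp⟩ := coherentBias_one_of_siegelZerosAbove
  exact ⟨C₀, hC₀, fun hz => not_coherentBias_of_fanDecorrelation one_ne_zero hF (himp hz)⟩

/-- `_false_of_` form: Siegel zeros of every logarithmic quality at arbitrarily large conductors
refute `FanDecorrelation` (hardness certificate; the hypothesis is believed false). -/
theorem FanDecorrelation_false_of_siegelZerosAbove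
    (hz : ∀ C₀ : ℝ, 0 < C₀ → SiegelZerosAbove (fun q => C₀ * Real.log q)) : ¬ FanDecorrelation :=
  fun hF => by
    obtain ⟨C₀, hC₀, hno⟩ := fanSiegelMirror hF
    exact hno (hz C₀ hC₀)

/-- **The fan mirror as a zero-free interval.**  Under `FanDecorrelation` alone there are `C₀ > 0` and
`q₀` such that `L(σ, χ) ≠ 0` for every conductor `q ≥ q₀`, every primitive quadratic `χ mod q` and every
real `σ ∈ [1 − 1/(C₀ log² q), 1)`. -/
theorem fanSiegelMirror_realZeroFree (hF : FanDecorrelation) :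
    ∃ C₀ : ℝ, 0 < C₀ ∧ ∃ q₀ : ℕ, ∀ (q : ℕ) [NeZero q] (χ : DirichletCharacter ℂ q),
      χ.IsPrimitive → χ.IsQuadratic → q₀ ≤ q →
        ∀ σ : ℝ, 1 - 1 / (C₀ * Real.log q ^ 2) ≤ σ → σ < 1 → χ.LFunction (σ : ℂ) ≠ 0 := by
  obtain ⟨C₀, hC₀, hno⟩ := fanSiegelMirror hF
  exact ⟨C₀, hC₀, realZeroFree_of_not_siegelZerosAbove hC₀ hno⟩

end Summit.Parity.GeneralizedHardyLittlewood.Theorems.FanDecorrelation.Negative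

end
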